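import Summits.CriticalPhenomena.PercolationContinuityZ3.Theorems.PercNearOneGluingNoHeavyLowerTailSahiCombDisjunctThreeIdentities

/-!
# The comb (tensor-Bernstein) hierarchy for Sahi's `E_k`, XX-B: DISJUNCTIVE CLOSURE AT ORDER 3 — OR-ing a fresh coordinate into any
# sub-collection of a comb-positive triple keeps it comb-positive; disjunctive padding by an OR-system; (M⁺-3) for OR-triples without a certificate

Support file of the one-cut programme (crux `NoHeavyLowerTail`, stmt-CriticalPhenomena-4575; cell `prim-masterthm`, seat P3, gen 4;
`run/shared/lean/prim/prim-masterthm/prim-masterthm-p3/HIERARCHY.md` §11).  Continues `…SahiCombDisjunctThreeIdentities` (the three explicit one-coordinate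
Bernstein decompositions of `E_3` at a coordinate that enters only as a disjunct).  Every piece there is a nonnegative combination of (M⁺-2)
covariances of increasing events (`combPos_covFun`) and of moments of nonnegative functions (`combPos_ex`), all ignoring `p_e`, times powers
`p_e^a(1−p_e)^b` with `a + b ≤ 3`; so the multidegree stays `3` and:
* **`combPos_sahiE_three_unionCoord_one/two/three`**, **`combPos_sahiE_three_unionCoord`** (any decidable sub-collection) — if `U_0,U_1,U_2` are
  increasing, ignore `e`, and `E_3(1_U)` is comb-positive at multidegree `3`, then so is `E_3` of `(U_j ∪ {e ∈ ω} (j ∈ G), U_j (j ∉ G))`;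
* **`combPos_sahiE_three_union_or`** — DISJUNCTIVE PADDING: for every comb-positive triple `U` of increasing events and coordinate sets
  `S_0,S_1,S_2` ignored by the `U_j`, `(U_k ∪ {ω | ω ∩ S_k ≠ ∅})_k` is comb-positive (induction on coordinates) — every proved cubic stratum
  absorbs an independent OR-system (with `…SahiCombRange`: all orders; with `…SahiCombCylinderPadding`: cylinders on top);
* applied to the empty triple `U = (∅,∅,∅)` (`E_3 ≡ 0`), `combPos_sahiE_three_union_or` is a certificate-free second proof of (M⁺-3) for every OR-triple,
  i.e. of `…SahiCombVennThree.combPos_sahiE_three_or` (whose proof is a 7-coin kernel `decide`); not restated here (same statement).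
The numerically supported all-order form (MIXTURE CONJECTURE, HIERARCHY §11; its smallest open cell `E_3`, `|G| = 2`, arbitrary pattern laws was
closed by ttrl cp-mix's exact certificate `run/shared/lean/ttrl/mix/certs/QA_qT_cert_deg3_p2.json`) is NOT asserted here.
HONEST FRAMING: nothing here asserts (M⁺-k) or `C_k` for `k ≥ 3` in general. [this work]
-/

noncomputable section

open scoped Classical

namespace Summit.CriticalPhenomena.PercolationContinuityZ3.Theorems

open Finset Function
open Literature.Combinatorics.Sahi2008
open Literature.Probability.Percolation.BHK2006 (ind_inter)
open Literature.Probability.Percolation.DecisionTree (ind ind_of_mem ind_of_not_mem ind_nonneg)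
open SahiComb

variable {ι : Type} [Fintype ι]

namespace SahiCombDisjunct

/-! ### Comb positivity of the pieces and of the three families -/

section Comb

variable (U : Fin 3 → Set (Set ι)) (hU : ∀ j, IsUpperSet (U j)) (e : ι)
  (hUe : ∀ (j : Fin 3) (b : Bool), secAt e b (U j) = U j)
  (h3 : CombPos (fun _ : ι => 3) (fun p => sahiE (bernoulliWeight p) 3 (fun j => ind (U j))))
include hU hUe h3

omit hU in
/-- `E_3(1_U)` as a comb certificate of multidegree `3` off `e` and `0` at `e`. [this work] -/
theorem combPos_sahiE_three_U_off :
    CombPos (update (fun _ : ι => 3) e 0) (fun p => sahiE (bernoulliWeight p) 3 ![ind (U 0), ind (U 1), ind (U 2)]) := by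
  have h3' : CombPos (fun _ : ι => 3) (fun p => sahiE (bernoulliWeight p) 3 ![ind (U 0), ind (U 1), ind (U 2)]) :=
    h3.congr fun p => by congr 1; funext j; fin_cases j <;> rfl
  exact h3'.of_ignores e (fun p s => sahiE_three_U_update U e hUe p s)

/-- **`|G| = 1`: OR-ing a fresh coordinate into ONE member keeps (M⁺-3).** [this work] -/
theorem combPos_sahiE_three_unionCoord_one :
    CombPos (fun _ : ι => 3) (fun p => sahiE (bernoulliWeight p) 3 ![ind (U 0 ∪ {ω : Set ι | e ∈ ω}), ind (U 1), ind (U 2)]) := by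
  have hA := combPos_sahiE_three_U_off U e hUe h3
  have hB : CombPos (update (fun _ : ι => 2) e 0) (covFun (U 1) (U 2)) :=
    (combPos_covFun (U 1) (U 2) (hU 1) (hU 2)).of_ignores e (fun p s => covFun_U_update U e hUe 1 2 p s)
  have h1 := (combPos_coord_pow e 0 1).mul_of_le hA (deg_le_three e (by norm_num) le_rfl)
  have h2 := (combPos_coord_pow e 1 0).mul_of_le hB (deg_le_three e (by norm_num) (by norm_num))
  refine (h1.add h2).congr fun p => ?_
  rw [sahiE_three_unionCoord_one U e hUe p]; ring

/-- **`|G| = 2`: OR-ing a fresh coordinate into TWO members keeps (M⁺-3).** [this work] -/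
theorem combPos_sahiE_three_unionCoord_two :
    CombPos (fun _ : ι => 3) (fun p => sahiE (bernoulliWeight p) 3
      ![ind (U 0 ∪ {ω : Set ι | e ∈ ω}), ind (U 1 ∪ {ω : Set ι | e ∈ ω}), ind (U 2)]) := by
  have hA := combPos_sahiE_three_U_off U e hUe h3
  have hB : CombPos (update (fun _ : ι => 2) e 0) (covFun (U 0 ∩ U 1) (U 2)) :=
    (combPos_covFun (U 0 ∩ U 1) (U 2) ((hU 0).inter (hU 1)) (hU 2)).of_ignores e (fun p s => covFun_UU_update U e hUe 0 1 2 p s)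
  have hC : CombPos (update (fun _ : ι => 2) e 0)
      (fun p => ex (bernoulliWeight p) (fun ω => (1 - ind (U 0) ω) * (1 - ind (U 1) ω) * ind (U 2) ω)) := by
    have h := (combPos_ex (ι := ι) (h := fun ω => (1 - ind (U 0) ω) * (1 - ind (U 1) ω) * ind (U 2) ω) fun ω =>
      mul_nonneg (mul_nonneg (sub_nonneg.2 (ind_le_one' _ ω)) (sub_nonneg.2 (ind_le_one' _ ω))) (ind_nonneg _ ω)).of_ignores e
      (fun p s => ex_cellFun_update U e hUe (fun x y z => (1 - x) * (1 - y) * z) p s)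
    exact h.mono fun x => by by_cases hx : x = e <;> simp [hx]
  have h1 := (combPos_coord_pow e 0 2).mul_of_le hA (deg_le_three e (by norm_num) le_rfl)
  have h2 := (combPos_coord_pow e 1 1).mul_of_le (hB.add hC) (deg_le_three e (by norm_num) (by norm_num))
  refine (h1.add h2).congr fun p => ?_
  rw [sahiE_three_unionCoord_two U e hUe p]; ring

/-- **`|G| = 3`: OR-ing a fresh coordinate into ALL THREE members keeps (M⁺-3).** [this work] -/
theorem combPos_sahiE_three_unionCoord_three :
    CombPos (fun _ : ι => 3) (fun p => sahiE (bernoulliWeight p) 3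
      ![ind (U 0 ∪ {ω : Set ι | e ∈ ω}), ind (U 1 ∪ {ω : Set ι | e ∈ ω}), ind (U 2 ∪ {ω : Set ι | e ∈ ω})]) := by
  have hA := combPos_sahiE_three_U_off U e hUe h3
  -- the cells, as comb certificates of multidegree 1 off `e`
  have cell : ∀ F : ℝ → ℝ → ℝ → ℝ, (∀ x y z : ℝ, 0 ≤ x → x ≤ 1 → 0 ≤ y → y ≤ 1 → 0 ≤ z → z ≤ 1 → 0 ≤ F x y z) →
      CombPos (update (fun _ : ι => 1) e 0)
        (fun p => ex (bernoulliWeight p) (fun ω => F (ind (U 0) ω) (ind (U 1) ω) (ind (U 2) ω))) := fun F hF =>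
    (combPos_ex (ι := ι) (h := fun ω => F (ind (U 0) ω) (ind (U 1) ω) (ind (U 2) ω)) fun ω =>
      hF _ _ _ (ind_nonneg _ ω) (ind_le_one' _ ω) (ind_nonneg _ ω) (ind_le_one' _ ω) (ind_nonneg _ ω)
        (ind_le_one' _ ω)).of_ignores e (fun p s => ex_cellFun_update U e hUe F p s)
  have hq0 := cell (fun x y z => (1 - x) * (1 - y) * (1 - z)) (fun x y z hx hx' hy hy' hz hz' =>
    mul_nonneg (mul_nonneg (sub_nonneg.2 hx') (sub_nonneg.2 hy')) (sub_nonneg.2 hz'))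
  have hqa := cell (fun x y z => (1 - y) * (1 - z) * x) (fun x y z hx hx' hy hy' hz hz' =>
    mul_nonneg (mul_nonneg (sub_nonneg.2 hy') (sub_nonneg.2 hz')) hx)
  have hqb := cell (fun x y z => (1 - x) * (1 - z) * y) (fun x y z hx hx' hy hy' hz hz' =>
    mul_nonneg (mul_nonneg (sub_nonneg.2 hx') (sub_nonneg.2 hz')) hy)
  have hqc := cell (fun x y z => (1 - x) * (1 - y) * z) (fun x y z hx hx' hy hy' hz hz' =>
    mul_nonneg (mul_nonneg (sub_nonneg.2 hx') (sub_nonneg.2 hy')) hz)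
  have hqab := cell (fun x y z => x * y * (1 - z)) (fun x y z hx hx' hy hy' hz hz' => mul_nonneg (mul_nonneg hx hy) (sub_nonneg.2 hz'))
  have hqac := cell (fun x y z => x * z * (1 - y)) (fun x y z hx hx' hy hy' hz hz' => mul_nonneg (mul_nonneg hx hz) (sub_nonneg.2 hy'))
  have hqbc := cell (fun x y z => y * z * (1 - x)) (fun x y z hx hx' hy hy' hz hz' => mul_nonneg (mul_nonneg hy hz) (sub_nonneg.2 hx'))
  have hX : CombPos (update (fun _ : ι => 2) e 0)
      (fun p => covFun (U 1 ∩ U 2) (U 0) p + covFun (U 0 ∩ U 2) (U 1) p + covFun (U 0 ∩ U 1) (U 2) p) :=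
    ((((combPos_covFun _ _ ((hU 1).inter (hU 2)) (hU 0)).of_ignores e (fun p s => covFun_UU_update U e hUe 1 2 0 p s)).add
      ((combPos_covFun _ _ ((hU 0).inter (hU 2)) (hU 1)).of_ignores e (fun p s => covFun_UU_update U e hUe 0 2 1 p s))).add
      ((combPos_covFun _ _ ((hU 0).inter (hU 1)) (hU 2)).of_ignores e (fun p s => covFun_UU_update U e hUe 0 1 2 p s)))
  have d11 : update (fun _ : ι => 1) e 0 + update (fun _ : ι => 1) e 0 = update (fun _ : ι => 2) e 0 := by
    funext x; by_cases hx : x = e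
    · subst hx; simp
    · simp [hx]
  have d12 : update (fun _ : ι => 1) e 0 ≤ update (fun _ : ι => 2) e 0 := fun x => by
    by_cases hx : x = e
    · subst hx; simp
    · simp [hx]
  -- the big bracket, multidegree 2 off e
  have hbr : CombPos (update (fun _ : ι => 2) e 0) (fun p =>
      (covFun (U 1 ∩ U 2) (U 0) p + covFun (U 0 ∩ U 2) (U 1) p + covFun (U 0 ∩ U 1) (U 2) p)
      + 2 * (ex (bernoulliWeight p) (fun ω => (1 - ind (U 1) ω) * (1 - ind (U 2) ω) * ind (U 0) ω)
            + ex (bernoulliWeight p) (fun ω => (1 - ind (U 0) ω) * (1 - ind (U 2) ω) * ind (U 1) ω)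
            + ex (bernoulliWeight p) (fun ω => (1 - ind (U 0) ω) * (1 - ind (U 1) ω) * ind (U 2) ω))
      + ex (bernoulliWeight p) (fun ω => (1 - ind (U 0) ω) * (1 - ind (U 1) ω) * (1 - ind (U 2) ω))
      + 3 * ex (bernoulliWeight p) (fun ω => (1 - ind (U 0) ω) * (1 - ind (U 1) ω) * (1 - ind (U 2) ω)) ^ 2
      + 2 * (ex (bernoulliWeight p) (fun ω => (1 - ind (U 1) ω) * (1 - ind (U 2) ω) * ind (U 0) ω)
              * ex (bernoulliWeight p) (fun ω => (1 - ind (U 0) ω) * (1 - ind (U 2) ω) * ind (U 1) ω)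
            + ex (bernoulliWeight p) (fun ω => (1 - ind (U 1) ω) * (1 - ind (U 2) ω) * ind (U 0) ω)
              * ex (bernoulliWeight p) (fun ω => (1 - ind (U 0) ω) * (1 - ind (U 1) ω) * ind (U 2) ω)
            + ex (bernoulliWeight p) (fun ω => (1 - ind (U 0) ω) * (1 - ind (U 2) ω) * ind (U 1) ω)
              * ex (bernoulliWeight p) (fun ω => (1 - ind (U 0) ω) * (1 - ind (U 1) ω) * ind (U 2) ω))
      + 3 * (ex (bernoulliWeight p) (fun ω => (1 - ind (U 0) ω) * (1 - ind (U 1) ω) * (1 - ind (U 2) ω))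
              * (ex (bernoulliWeight p) (fun ω => (1 - ind (U 1) ω) * (1 - ind (U 2) ω) * ind (U 0) ω)
                + ex (bernoulliWeight p) (fun ω => (1 - ind (U 0) ω) * (1 - ind (U 2) ω) * ind (U 1) ω)
                + ex (bernoulliWeight p) (fun ω => (1 - ind (U 0) ω) * (1 - ind (U 1) ω) * ind (U 2) ω)))
      + (ex (bernoulliWeight p) (fun ω => (1 - ind (U 1) ω) * (1 - ind (U 2) ω) * ind (U 0) ω)
            * ex (bernoulliWeight p) (fun ω => ind (U 1) ω * ind (U 2) ω * (1 - ind (U 0) ω))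
          + ex (bernoulliWeight p) (fun ω => (1 - ind (U 0) ω) * (1 - ind (U 2) ω) * ind (U 1) ω)
            * ex (bernoulliWeight p) (fun ω => ind (U 0) ω * ind (U 2) ω * (1 - ind (U 1) ω))
          + ex (bernoulliWeight p) (fun ω => (1 - ind (U 0) ω) * (1 - ind (U 1) ω) * ind (U 2) ω)
            * ex (bernoulliWeight p) (fun ω => ind (U 0) ω * ind (U 1) ω * (1 - ind (U 2) ω)))
      + ex (bernoulliWeight p) (fun ω => (1 - ind (U 0) ω) * (1 - ind (U 1) ω) * (1 - ind (U 2) ω))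
          * (ex (bernoulliWeight p) (fun ω => ind (U 0) ω * ind (U 1) ω * (1 - ind (U 2) ω))
            + ex (bernoulliWeight p) (fun ω => ind (U 0) ω * ind (U 2) ω * (1 - ind (U 1) ω))
            + ex (bernoulliWeight p) (fun ω => ind (U 1) ω * ind (U 2) ω * (1 - ind (U 0) ω)))) := by
    have s1 := (hqa.add hqb).add hqc
    have s2 := (hqab.add hqac).add hqbc
    refine ((((((hX.add ((s1.mono d12).smul (by norm_num : (0:ℝ) ≤ 2))).add (hq0.mono d12)).add
      (((hq0.mul_of_eq hq0 d11).congr fun p => by ring).smul (by norm_num : (0:ℝ) ≤ 3))).add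
      ((((hqa.mul_of_eq hqb d11).add (hqa.mul_of_eq hqc d11)).add (hqb.mul_of_eq hqc d11)).smul (by norm_num : (0:ℝ) ≤ 2))).add
      ((hq0.mul_of_eq s1 d11).smul (by norm_num : (0:ℝ) ≤ 3))).add
      (((hqa.mul_of_eq hqbc d11).add (hqb.mul_of_eq hqac d11)).add (hqc.mul_of_eq hqab d11))).add (hq0.mul_of_eq s2 d11)
  have hB2 : CombPos (update (fun _ : ι => 2) e 0) (fun p =>
      ex (bernoulliWeight p) (fun ω => (1 - ind (U 0) ω) * (1 - ind (U 1) ω) * (1 - ind (U 2) ω))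
      + (ex (bernoulliWeight p) (fun ω => (1 - ind (U 1) ω) * (1 - ind (U 2) ω) * ind (U 0) ω)
          + ex (bernoulliWeight p) (fun ω => (1 - ind (U 0) ω) * (1 - ind (U 2) ω) * ind (U 1) ω)
          + ex (bernoulliWeight p) (fun ω => (1 - ind (U 0) ω) * (1 - ind (U 1) ω) * ind (U 2) ω))) :=
    (hq0.add ((hqa.add hqb).add hqc)).mono d12
  have h1 := (combPos_coord_pow e 0 3).mul_of_le hA (deg_le_three e (by norm_num) le_rfl)
  have h2 := ((combPos_coord_pow e 1 2).mul_of_le hbr (deg_le_three e (by norm_num) (by norm_num))).smul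
    (by norm_num : (0:ℝ) ≤ 1 / 2)
  have h3' := (combPos_coord_pow e 2 1).mul_of_le hB2 (deg_le_three e (by norm_num) (by norm_num))
  refine ((h1.add h2).add h3').congr fun p => ?_
  rw [sahiE_three_unionCoord_three U e hUe p]; ring

end Comb


/-! ### Any sub-collection; disjunctive padding by an OR-system; OR-triples without a certificate -/

section AnySub

variable (U : Fin 3 → Set (Set ι)) (hU : ∀ j, IsUpperSet (U j)) (e : ι)
  (hUe : ∀ (j : Fin 3) (b : Bool), secAt e b (U j) = U j)
  (h3 : CombPos (fun _ : ι => 3) (fun p => sahiE (bernoulliWeight p) 3 (fun j => ind (U j))))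

/-- Slot permutations keep comb positivity of `E_3` (`E_n` is symmetric, `sahiE_comp_perm`). [folklore] -/
theorem combPos_three_perm {c : ι → ℕ} {f : Fin 3 → Set ι → ℝ} (σ : Equiv.Perm (Fin 3))
    (h : CombPos c (fun p => sahiE (bernoulliWeight p) 3 f)) :
    CombPos c (fun p => sahiE (bernoulliWeight p) 3 (fun j => f (σ j))) :=
  h.congr fun p => sahiE_comp_perm (bernoulliWeight p) 3 σ f

include hU hUe h3 in
/-- **DISJUNCTIVE CLOSURE AT ORDER 3, any sub-collection.**  For increasing `U_0,U_1,U_2` ignoring the coordinate `e` with `E_3(1_U)`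
comb-positive at multidegree `3`, and any decidable `P ⊆ {0,1,2}`: the triple `(U_j ∪ {e ∈ ω} if P j, else U_j)` has `E_3` comb-positive at
multidegree `3`. [this work] -/
theorem combPos_sahiE_three_unionCoord (P : Fin 3 → Prop) [DecidablePred P] :
    CombPos (fun _ : ι => 3) (fun p => sahiE (bernoulliWeight p) 3
      (fun j => ind (if P j then U j ∪ {ω : Set ι | e ∈ ω} else U j))) := by
  -- hypotheses for the permuted families
  have hU' : ∀ σ : Equiv.Perm (Fin 3), ∀ j, IsUpperSet ((U ∘ σ) j) := fun σ j => hU _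
  have hUe' : ∀ σ : Equiv.Perm (Fin 3), ∀ (j : Fin 3) (b : Bool), secAt e b ((U ∘ σ) j) = (U ∘ σ) j := fun σ j b => hUe _ b
  have h3' : ∀ σ : Equiv.Perm (Fin 3),
      CombPos (fun _ : ι => 3) (fun p => sahiE (bernoulliWeight p) 3 (fun j => ind ((U ∘ σ) j))) := fun σ =>
    combPos_three_perm (f := fun j => ind (U j)) σ h3
  by_cases h0 : P 0 <;> by_cases h1 : P 1 <;> by_cases h2 : P 2
  · exact (combPos_sahiE_three_unionCoord_three U hU e hUe h3).congr fun p =>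
      congrArg (sahiE (bernoulliWeight p) 3) (funext fun j => by fin_cases j <;> simp [h0, h1, h2])
  · exact (combPos_sahiE_three_unionCoord_two U hU e hUe h3).congr fun p =>
      congrArg (sahiE (bernoulliWeight p) 3) (funext fun j => by fin_cases j <;> simp [h0, h1, h2])
  · exact (combPos_three_perm (Equiv.swap 1 2)
        (combPos_sahiE_three_unionCoord_two (U ∘ Equiv.swap 1 2) (hU' _) e (hUe' _) (h3' _))).congr fun p =>
      congrArg (sahiE (bernoulliWeight p) 3) (funext fun j => by
        fin_cases j <;> simp [h0, h1, h2, Equiv.swap_apply_of_ne_of_ne])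
  · exact (combPos_sahiE_three_unionCoord_one U hU e hUe h3).congr fun p =>
      congrArg (sahiE (bernoulliWeight p) 3) (funext fun j => by fin_cases j <;> simp [h0, h1, h2])
  · exact (combPos_three_perm (Equiv.swap 0 2)
        (combPos_sahiE_three_unionCoord_two (U ∘ Equiv.swap 0 2) (hU' _) e (hUe' _) (h3' _))).congr fun p =>
      congrArg (sahiE (bernoulliWeight p) 3) (funext fun j => by
        fin_cases j <;> simp [h0, h1, h2, Equiv.swap_apply_of_ne_of_ne])
  · exact (combPos_three_perm (Equiv.swap 0 1)
        (combPos_sahiE_three_unionCoord_one (U ∘ Equiv.swap 0 1) (hU' _) e (hUe' _) (h3' _))).congr fun p =>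
      congrArg (sahiE (bernoulliWeight p) 3) (funext fun j => by
        fin_cases j <;> simp [h0, h1, h2, Equiv.swap_apply_of_ne_of_ne])
  · exact (combPos_three_perm (Equiv.swap 0 2)
        (combPos_sahiE_three_unionCoord_one (U ∘ Equiv.swap 0 2) (hU' _) e (hUe' _) (h3' _))).congr fun p =>
      congrArg (sahiE (bernoulliWeight p) 3) (funext fun j => by
        fin_cases j <;> simp [h0, h1, h2, Equiv.swap_apply_of_ne_of_ne])
  · exact h3.congr fun p =>
      congrArg (sahiE (bernoulliWeight p) 3) (funext fun j => by fin_cases j <;> simp [h0, h1, h2])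

end AnySub

section OrSystem

omit [Fintype ι] in
/-- OR-events over coordinates not containing `e` ignore `e`. [folklore] -/
theorem secAt_orEvent_of_notMem (e : ι) (R : Finset ι) (he : e ∉ R) (b : Bool) :
    secAt e b {ω : Set ι | ∃ i ∈ R, i ∈ ω} = {ω : Set ι | ∃ i ∈ R, i ∈ ω} := by
  ext ω
  simp only [mem_secAt, Set.mem_setOf_eq]
  constructor
  · rintro ⟨i, hi, hiω⟩
    have hie : i ≠ e := fun h => he (h ▸ hi)
    refine ⟨i, hi, ?_⟩
    cases b
    · simp only [forceAt, cond_false, Set.mem_sdiff, Set.mem_singleton_iff] at hiω; exact hiω.1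
    · simp only [forceAt, cond_true, Set.mem_insert_iff] at hiω; exact hiω.resolve_left hie
  · rintro ⟨i, hi, hiω⟩
    have hie : i ≠ e := fun h => he (h ▸ hi)
    refine ⟨i, hi, ?_⟩
    cases b
    · simp only [forceAt, cond_false, Set.mem_sdiff, Set.mem_singleton_iff]; exact ⟨hiω, hie⟩
    · simp only [forceAt, cond_true, Set.mem_insert_iff]; exact Or.inr hiω

omit [Fintype ι] in
/-- OR-events are increasing. [folklore] -/
theorem isUpperSet_orEvent (R : Finset ι) : IsUpperSet {ω : Set ι | ∃ i ∈ R, i ∈ ω} :=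
  fun _ _ hle ⟨i, hi, hiω⟩ => ⟨i, hi, hle hiω⟩

/-- **DISJUNCTIVE PADDING BY AN INDEPENDENT OR-SYSTEM (order 3).**  Let `U_0,U_1,U_2` be increasing events with `E_3(1_U)` comb-positive at
multidegree `3`, and `S_0,S_1,S_2` sets of coordinates every one of which is ignored by every `U_j`.  Then the triple
`(U_k ∪ {ω | ω ∩ S_k ≠ ∅})_{k<3}` has `E_3` comb-positive at multidegree `3` (induction on the coordinates of `⋃ S_k`, one disjunctive
closure step each). [this work] -/
theorem combPos_sahiE_three_union_or (U : Fin 3 → Set (Set ι)) (hU : ∀ j, IsUpperSet (U j)) (S : Fin 3 → Finset ι)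
    (hUS : ∀ (j k : Fin 3), ∀ e ∈ S k, ∀ b : Bool, secAt e b (U j) = U j)
    (h3 : CombPos (fun _ : ι => 3) (fun p => sahiE (bernoulliWeight p) 3 (fun j => ind (U j)))) :
    CombPos (fun _ : ι => 3) (fun p => sahiE (bernoulliWeight p) 3 (fun k => ind (U k ∪ {ω : Set ι | ∃ i ∈ S k, i ∈ ω}))) := by
  classical
  suffices key : ∀ T : Finset ι, CombPos (fun _ : ι => 3)
      (fun p => sahiE (bernoulliWeight p) 3 (fun k => ind (U k ∪ {ω : Set ι | ∃ i ∈ S k ∩ T, i ∈ ω}))) by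
    refine (key Finset.univ).congr fun p => ?_
    congr 1; funext k
    simp only [Finset.inter_univ]
  intro T
  induction T using Finset.induction_on with
  | empty =>
    refine h3.congr fun p => ?_
    congr 1; funext k; congr 1
    ext ω; simp
  | insert e T heT ih =>
    by_cases hk : ∃ k, e ∈ S k
    · obtain ⟨k₀, hk₀⟩ := hk
      set W : Fin 3 → Set (Set ι) := fun k => U k ∪ {ω : Set ι | ∃ i ∈ S k ∩ T, i ∈ ω} with hW
      have hWup : ∀ k, IsUpperSet (W k) := fun k => (hU k).union (isUpperSet_orEvent _)
      have hWe : ∀ (k : Fin 3) (b : Bool), secAt e b (W k) = W k := fun k b => by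
        rw [hW]; dsimp only
        rw [secAt_union, hUS k k₀ e hk₀ b,
          secAt_orEvent_of_notMem e (S k ∩ T) (fun h => heT (Finset.mem_inter.1 h).2) b]
      have h := combPos_sahiE_three_unionCoord W hWup e hWe ih (fun k => e ∈ S k)
      refine h.congr fun p => ?_
      congr 1; funext k; congr 1
      ext ω
      by_cases hke : e ∈ S k
      · simp only [hke, if_true, hW, Set.mem_union, Set.mem_setOf_eq, Finset.mem_inter, Finset.mem_insert]
        constructor
        · rintro (hω | ⟨i, ⟨hiS, rfl | hiT⟩, hiω⟩)
          · exact Or.inl (Or.inl hω)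
          · exact Or.inr hiω
          · exact Or.inl (Or.inr ⟨i, ⟨hiS, hiT⟩, hiω⟩)
        · rintro ((hω | ⟨i, ⟨hiS, hiT⟩, hiω⟩) | hω)
          · exact Or.inl hω
          · exact Or.inr ⟨i, ⟨hiS, Or.inr hiT⟩, hiω⟩
          · exact Or.inr ⟨e, ⟨hke, Or.inl rfl⟩, hω⟩
      · simp only [hke, if_false, hW, Set.mem_union, Set.mem_setOf_eq, Finset.mem_inter, Finset.mem_insert]
        constructor
        · rintro (hω | ⟨i, ⟨hiS, rfl | hiT⟩, hiω⟩)
          · exact Or.inl hω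
          · exact absurd hiS hke
          · exact Or.inr ⟨i, ⟨hiS, hiT⟩, hiω⟩
        · rintro (hω | ⟨i, ⟨hiS, hiT⟩, hiω⟩)
          · exact Or.inl hω
          · exact Or.inr ⟨i, ⟨hiS, Or.inr hiT⟩, hiω⟩
    · have hk' : ∀ k, e ∉ S k := fun k h => hk ⟨k, h⟩
      refine ih.congr fun p => ?_
      congr 1; funext k; congr 1
      ext ω
      simp only [Set.mem_union, Set.mem_setOf_eq, Finset.mem_inter, Finset.mem_insert]
      constructor
      · rintro (hω | ⟨i, ⟨hiS, rfl | hiT⟩, hiω⟩)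
        · exact Or.inl hω
        · exact absurd hiS (hk' k)
        · exact Or.inr ⟨i, ⟨hiS, hiT⟩, hiω⟩
      · rintro (hω | ⟨i, ⟨hiS, hiT⟩, hiω⟩)
        · exact Or.inl hω
        · exact Or.inr ⟨i, ⟨hiS, Or.inr hiT⟩, hiω⟩

/-- Law-level shadow of `combPos_sahiE_three_union_or`: Sahi's `E_3(μ_p) ≥ 0` for the padded triple, every product measure. [this work] -/
theorem sahiE_three_nonneg_union_or (q : ι → unitInterval) (U : Fin 3 → Set (Set ι)) (hU : ∀ j, IsUpperSet (U j))
    (S : Fin 3 → Finset ι) (hUS : ∀ (j k : Fin 3), ∀ e ∈ S k, ∀ b : Bool, secAt e b (U j) = U j)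
    (h3 : CombPos (fun _ : ι => 3) (fun p => sahiE (bernoulliWeight p) 3 (fun j => ind (U j)))) :
    0 ≤ sahiE (bernoulliWeight q) 3 (fun k => ind (U k ∪ {ω : Set ι | ∃ i ∈ S k, i ∈ ω})) :=
  (combPos_sahiE_three_union_or U hU S hUS h3).nonneg q

end OrSystem

end SahiCombDisjunct

end Summit.CriticalPhenomena.PercolationContinuityZ3.Theorems

end
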